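import Mathlib

/-!
# Negative knowledge on crux `BoundaryClosureR` (stmt-CriticalPhenomena-14004), line `pick-half-plane`:
the class-sign table behind the failure of `BoundaryHalfPlaneBounds` (i′) on CURLED carriers

Context (drefute seat, 2026-08-16; evidence `halfPlaneInputs.md` on the item, `Cruxes/BoundaryClosureR/Disproof.lean` §6).
For the normalised developing map `h_δ = δ(H − H(s_b))/F_δ(b_δ)` of the line, (E2) + winding rigidity give the
exact boundary-step law: crossing the 𝕋-edge dual to a boundary edge `e ≠ a` counter-clockwise changes `Re h_δ` by
`T′·sin((3/8)(W_e − W_b))·Z_δ(e)`, and crossing the root edge by `T′·sin((5/8)W_b)`, `T′ = (ℓ/2)δ/Z_δ(b_δ) → ∞`,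
where `W_b = W(a→b) = π + 2πn` and, by (E4), `W_e = +π` on the root's west floor arm, `−π` on its east arm.
Hence at the root's OWN boundary sites `Re h_δ/T′ = sin(5πn/4)·S_W + O(1/T′)` (west) and
`sin(5πn/4)·S_W + sin(5π/8 + 5πn/4)` (east), `S_W ≥ x_c³ > 0` the west-arm arrival mass: bounded below uniformly
(what (i′) of the lead's reshape r2 asks at ALL boundary sites) iff `sin(5πn/4) ≥ 0 ∧ sin(π/4 + 5πn/4) ≥ 0`, i.e.
`n ∈ {0, −1, 2, −3} (mod 8)`.  The flat census classes are `n = 0` (`W_b = π`) and `n = −1` (`W_b = −π`); a Jordan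
carrier whose boundary curls once between the gate and the root piece realises `W_b = 3π` (`n = 1`), where both
coefficients below are NEGATIVE, so `Re h_δ` at the root sites `→ −∞` and (i′) fails; direction `1` does not rotate
with the class, the wedge direction `ω = −e^{i(5/8)W_b}` does (repair: state the boundary bound in direction `ω`).
This file records the four elementary sign facts of class `3π` and the closure identity used; the lattice
identities themselves are the line's stub `BoundaryExactness` (E2)/(E4).  Everything proved. [folklore]
-/

noncomputable section

namespace Summit.CriticalPhenomena.SAWScalingLimit.Theorems.BoundaryClosureR.Negative

/-- Class `W_b = π` (the census class, normaliser reached from the root along an uncurled arc): the root step of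
`Re h_δ` has the POSITIVE coefficient `sin(5π/8)`. [folklore] -/
theorem rootStep_coeff_pos_class_pi : 0 < Real.sin (5 / 8 * Real.pi) :=
  Real.sin_pos_of_pos_of_lt_pi (by positivity) (by nlinarith [Real.pi_pos])

/-- Class `W_b = −π` (the mirror census class): the root step has the NEGATIVE coefficient `sin(−5π/8)`, harmless
there because the site reached from the gate is the EAST one (the west site then sits `sin(5π/8)·T′` above it).
[folklore] -/
theorem rootStep_coeff_neg_class_neg_pi : Real.sin (5 / 8 * (-Real.pi)) < 0 := by
  rw [mul_neg, Real.sin_neg, neg_lt_zero]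
  exact rootStep_coeff_pos_class_pi

/-- Class `W_b = 3π` (one curl of `∂Ω` between the gate and the root piece): the root step of `Re h_δ` has the
NEGATIVE coefficient `sin((5/8)·3π) = sin(15π/8) = −sin(π/8)`. [folklore] -/
theorem rootStep_coeff_neg_class_three_pi : Real.sin (5 / 8 * (3 * Real.pi)) < 0 := by
  have h : 5 / 8 * (3 * Real.pi) = 2 * Real.pi - Real.pi / 8 := by ring
  rw [h, Real.sin_two_pi_sub, neg_lt_zero]
  exact Real.sin_pos_of_pos_of_lt_pi (by positivity) (by nlinarith [Real.pi_pos])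

/-- Class `W_b = 3π`: moving east along the root's WEST floor arm towards the root (`W_e = +π`), each boundary
edge changes `Re h_δ` by `−sin((3/8)π + (5/8)·3π)·Z(e)·T′ = −sin(π/4)·Z(e)·T′ < 0`: the west arm DESCENDS into the
root by `(√2/2)·S_W·T′ → ∞` in total — the west root site violates every fixed lower bound `−M`. [folklore] -/
theorem westArmStep_coeff_neg_class_three_pi :
    -Real.sin (3 / 8 * Real.pi + 5 / 8 * (3 * Real.pi)) < 0 := by
  have h : 3 / 8 * Real.pi + 5 / 8 * (3 * Real.pi) = Real.pi / 4 + 2 * Real.pi := by ring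
  rw [h, Real.sin_add_two_pi, neg_lt_zero]
  exact Real.sin_pos_of_pos_of_lt_pi (by positivity) (by nlinarith [Real.pi_pos])

/-- Class `W_b = 3π`: moving east along the root's EAST arm away from the root (`W_e = −π`), each edge changes
`Re h_δ` by `−sin(−(3/8)π + (5/8)·3π)·Z(e)·T′ = +Z(e)·T′ > 0` — `Re h_δ` recovers only past the root. [folklore] -/
theorem eastArmStep_coeff_pos_class_three_pi :
    0 < -Real.sin (-(3 / 8 * Real.pi) + 5 / 8 * (3 * Real.pi)) := by
  have h : -(3 / 8 * Real.pi) + 5 / 8 * (3 * Real.pi) = Real.pi / 2 + Real.pi := by ring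
  rw [h, Real.sin_add_pi, Real.sin_pi_div_two]
  norm_num

/-- The closure of the boundary image in class `3π` at the half-plane arm mass `S = 1/(2 sin(π/8))`
(`−sin(π/4)·S − sin(π/8) + 1·S = 0`, i.e. `S(1 − sin(π/4)) = sin(π/8)`) reduces to the elementary identity
`1 − sin(π/4) = 2 sin²(π/8)`. [folklore] -/
theorem closure_class_three_pi : 1 - Real.sin (Real.pi / 4) = 2 * Real.sin (Real.pi / 8) ^ 2 := by
  have h : Real.sin (Real.pi / 4) = Real.cos (2 * (Real.pi / 8)) := by
    rw [← Real.cos_pi_div_two_sub]; congr 1; ring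
  rw [h, Real.cos_two_mul, Real.cos_sq']
  ring

/-- The same closure, multiplied out: with `S = 1/(2 sin(π/8))` the three class-`3π` coefficients of the
west arm, the root and the east arm sum to zero, `−sin(π/4)·S − sin(π/8) + S = 0`. [folklore] -/
theorem closure_class_three_pi' :
    -Real.sin (Real.pi / 4) * (1 / (2 * Real.sin (Real.pi / 8))) - Real.sin (Real.pi / 8)
      + 1 / (2 * Real.sin (Real.pi / 8)) = 0 := by
  have hs : 0 < Real.sin (Real.pi / 8) :=
    Real.sin_pos_of_pos_of_lt_pi (by positivity) (by nlinarith [Real.pi_pos])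
  have hc := closure_class_three_pi
  field_simp
  nlinarith [hc]

end Summit.CriticalPhenomena.SAWScalingLimit.Theorems.BoundaryClosureR.Negative

end
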